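import Literature.Barriers.QuantumAdvantage.CohenGenericJoinPneNP
import Literature.Computability.Complexity.OracleQueryMap
import Literature.Computability.Complexity.OracleBPP
import Literature.Computability.Complexity.MultilinearExtension
import Literature.Computability.QuantumComplexity.OracleSeparationBQPPHProofs
import Literature.Computability.QuantumComplexity.BPPRelSubsetBQPRel
import Literature.Computability.QuantumComplexity.CoinFamilyKernelProofs
import Literature.Computability.QuantumComplexity.AccGapMachine
import HarnessLib

/-!
# Fenner–Fortnow–Kurtz–Li Thm. 6.18 (2) rerelativized, reduced to the Standard Algorithm: `AWPP^{B ⊕ G} = P^{B ⊕ G}` for generic `G` from the collapse of categorical machines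

Support file for the named fact
`Literature.Barriers.QuantumAdvantage.fennerFortnowKurtzLi2003_thm618_awpp`
(`FortnowRogersOracle.lean`): for every Karp-`PSPACE`-complete `B` there is a countable family
`𝒮` of sets of Cohen conditions with `P^{B ⊕ G} = AWPP^{B ⊕ G}` for every `𝒮`-generic `G`
(Fenner–Fortnow–Kurtz–Li, *An oracle builder's toolkit*, Inform. and Comput. 182 (2003),
Thm. 6.18 (2) with the rerelativization of pp. 33–34; = Fortnow–Rogers 1999 Thm. 3.6 joined
with a `PSPACE`-complete `H`).

**The printed proof** (§6.3–6.5, pp. 28–33). The requirement of a (counting) machine `M` is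
`Rᵢ`: "Either `M^X` is not proper or `L(M^X) ∈ P^X`" (Lemma 6.8). §6.5: "if a machine is not
categorical over some (finite!) Cohen condition, we can force it not to be proper and hence
discard it from consideration. Then … we need only deal with categorical machines", for which
the **Standard Algorithm** (Fig. 1, p. 29: `α := ∅; while true: if f^σ(x, α) = 1 accept; if
= 0 reject; ⟨β₀, β₁⟩ := f^σ(x, α); α := α ∪ (G restricted to dom β₀ ∪ dom β₁)`) decides
`L(M^G)` in polynomial time relative to `G ⊕ F_j` (Lemma 6.16), `F_j ∈ FPSPACE` for `AWPP`
(Lemma 6.17 and the remark after it, via the certificate complexity bound of Thm. 6.13), hence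
in `P^{B ⊕ G}` when `P^B = PSPACE` (Thm. 6.18 (2), rerelativized).

**This file** formalizes the requirement/genericity layer of that proof and REDUCES the named
fact, by proof, to the collapse statement for categorical machines (the Standard Algorithm
proper, a statement about `P^{B ⊕ G}` machines, to be supplied by the sibling machine files):

* `AWPPDescr` — a description of an `AWPP^{B ⊕ ·}` predicate in the tree's models: two
  counting machines `M₁, M₂` (`OracleAlg Bool`, run against `Oracle.ofLanguage (B ⊕ Z)` with
  fuels `q₁(|z|)`, `q₂(|z|)`), witness lengths `r₁, r₂` and a gap exponent `p`
  (`AWPPRel`/`GapPRel`/`SharpPRel`/`countWitnesses` of `CountingSimulationRel.lean`,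
  `Counting.lean`); its gap `AWPPDescr.gap B Z x = #₁ - #₂`, promise `AWPPDescr.Prom`
  (`2/3 ≤ gap/2^p ≤ 1 ∨ 0 ≤ gap/2^p ≤ 1/3`, Fenner's constant-error form, Def. 6.1 with
  [Fenner 2003]), language `AWPPDescr.lang`, well-formedness `AWPPDescr.WellFormed`
  (polynomial-time machines that output on every run and ask only short queries — the normal
  form `(M.capQ q).clock q` of `OracleQueryMap.lean`, `AWPPDescr.normalize`), and
  `AWPPDescr.Categorical B Δ σ` ("`M` is categorical over `σ`": the promise holds at every
  input for EVERY oracle extending `σ`);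
* `FFKL.req` — the requirement "if the promise holds everywhere then the language is in
  `P^{B ⊕ G}`", `FFKL.family B` — the forcing sets of the requirements of all well-formed
  descriptions (countable: `FFKL.family_countable`);
* PROVED, the finite-extension half (§6.5): `AWPPDescr.prom_congr` (the promise at `x` reads
  finitely many strings of `Z`: the `Z`-parts of the queries of the two machines on the
  witnesses of `x`, `AWPPDescr.zQueries`), whence `FFKL.exists_forces_not_prom` (a violation
  of the promise below `τ` is forced by a finite extension of `τ`) and the DENSITY of every
  forcing set GIVEN the collapse of categorical machines (`FFKL.isDense_forces_req_of_stdAlg`: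
  either some extension violates the promise — force it — or the description is categorical
  over `τ` itself, and `τ` forces the requirement by the Standard Algorithm);
* PROVED, the extraction (§6.1, Def. 6.1 in the tree's `AWPPRel`): every `AWPP^{B ⊕ G}` language
  is the language of a well-formed description whose promise holds at `G`
  (`AWPPDescr.exists_of_mem_AWPPRel`), and `P^{B ⊕ G} ⊆ AWPP^{B ⊕ G}` unconditionally
  (`PRel_subset_AWPPRel_join`, through the tree's proved `P^A ⊆ BQP^A ⊆ AWPP^A`);
* the ASSEMBLY `fennerFortnowKurtzLi2003_thm618_awpp_of_stdAlg`: Thm. 6.18 (2) rerelativized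
  follows from the Standard-Algorithm statement
  `∀ B, IsComplete PSPACE B → ∀ Δ σ, Δ.WellFormed → Δ.Categorical B σ → ∀ G, σ.ExtendedBy G →
  Δ.lang B G ∈ P^{B ⊕ G}` (kept as an explicit hypothesis; no named fact is introduced).

## References

* [FennerFortnowKurtzLi2003IC] §6.1 Def. 6.1 (p. 25), §6.3 Lemma 6.8 and Fig. 1 (pp. 28–29),
  Lemma 6.9, §6.5 (p. 32: categorical machines over finite conditions), Lemma 6.16, Lemma 6.17,
  Thm. 6.18 (2) (p. 33), pp. 33–34 (rerelativization), read via
  `lit read doi:10.1016/s0890-5401(03)00018-x --pages 25-34`.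
* [FortnowRogers1999JCSS] Thm. 3.6 and §3, proof of Cor. 3.7 (arXiv numbering).
* [Fenner2003] S. Fenner, *PP-lowness and a simple definition of AWPP*, Theory Comput. Syst. 36
  (2003) (robustness of the constant-error form).
-/

noncomputable section

namespace Literature.Barriers.QuantumAdvantage

open _root_.Computability Literature.Computability.Complexity Literature.Computability.Complexity.Classes
  Literature.Computability.Complexity.CohenCondition Literature.Computability.QuantumComplexity Finset

/-! ### Descriptions of `AWPP^{B ⊕ ·}` predicates -/

/-- **A description of an `AWPP^{B ⊕ ·}` predicate** (the data of Def. 6.1 in the tree's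
one-`GapP`-function form `AWPPRel`): two counting machines with their fuels (the two `#P^{B ⊕ Z}`
functions of a `GapP^{B ⊕ Z}` difference), their witness lengths, and the gap exponent `p`
(`gap/2^{p(|x|)} ∈ [0,1/3] ∪ [2/3,1]`). The base oracle `B` is a parameter of the semantics.
[cite: FennerFortnowKurtzLi2003IC, Def. 6.1 (p. 25)] -/
structure AWPPDescr where
  /-- The machine counting positively. -/
  M₁ : OracleAlg Bool
  /-- The machine counting negatively. -/
  M₂ : OracleAlg Bool
  /-- Fuel (and query-length bound) of `M₁`. -/
  q₁ : Polynomial ℕ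
  /-- Fuel (and query-length bound) of `M₂`. -/
  q₂ : Polynomial ℕ
  /-- Witness length of the first count. -/
  r₁ : Polynomial ℕ
  /-- Witness length of the second count. -/
  r₂ : Polynomial ℕ
  /-- The gap exponent. -/
  p : Polynomial ℕ

namespace AWPPDescr

variable (Δ : AWPPDescr) (B : Language Bool)

/-- `M₁` accepts `z` against `B ⊕ Z` within its fuel. [cite: FennerFortnowKurtzLi2003IC, Def. 6.1 (p. 25)] -/
def acc₁ (Z : Language Bool) (z : List Bool) : Prop :=
  Δ.M₁.run (Oracle.ofLanguage (oracleJoin B Z)) (Δ.q₁.eval z.length) z = some true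

/-- `M₂` accepts `z` against `B ⊕ Z` within its fuel. [cite: FennerFortnowKurtzLi2003IC, Def. 6.1 (p. 25)] -/
def acc₂ (Z : Language Bool) (z : List Bool) : Prop :=
  Δ.M₂.run (Oracle.ofLanguage (oracleJoin B Z)) (Δ.q₂.eval z.length) z = some true

/-- The first count `#{y ∈ {0,1}^{r₁(|x|)} : M₁ accepts ⟨x, y⟩}`. [cite: FennerFortnowKurtzLi2003IC, Def. 6.1 (p. 25)] -/
def cnt₁ (Z : Language Bool) (x : List Bool) : ℕ :=
  countWitnesses {z | Δ.acc₁ B Z z} (Δ.r₁.eval x.length) x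

/-- The second count `#{y ∈ {0,1}^{r₂(|x|)} : M₂ accepts ⟨x, y⟩}`. [cite: FennerFortnowKurtzLi2003IC, Def. 6.1 (p. 25)] -/
def cnt₂ (Z : Language Bool) (x : List Bool) : ℕ :=
  countWitnesses {z | Δ.acc₂ B Z z} (Δ.r₂.eval x.length) x

/-- The gap `g(x) = #₁ - #₂` relative to `B ⊕ Z`. [cite: FennerFortnowKurtzLi2003IC, Def. 6.1 (p. 25)] -/
def gap (Z : Language Bool) (x : List Bool) : ℤ :=
  (Δ.cnt₁ B Z x : ℤ) - (Δ.cnt₂ B Z x : ℤ)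

/-- **The `AWPP` promise at `x`** (Fenner's constant-error form, as in `AWPPRel`):
`2/3 ≤ g(x)/2^{p(|x|)} ≤ 1` or `0 ≤ g(x)/2^{p(|x|)} ≤ 1/3`. [cite: FennerFortnowKurtzLi2003IC, Def. 6.1 (p. 25)] [cite: Fenner2003, Thm. 1.2] -/
def Prom (Z : Language Bool) (x : List Bool) : Prop :=
  (2 * (2 : ℤ) ^ Δ.p.eval x.length ≤ 3 * Δ.gap B Z x ∧ Δ.gap B Z x ≤ (2 : ℤ) ^ Δ.p.eval x.length) ∨
    (0 ≤ Δ.gap B Z x ∧ 3 * Δ.gap B Z x ≤ (2 : ℤ) ^ Δ.p.eval x.length)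

/-- **The language described** relative to `B ⊕ Z`: `g(x)/2^{p(|x|)} ≥ 2/3`. [cite: FennerFortnowKurtzLi2003IC, Def. 6.1 (p. 25)] -/
def lang (Z : Language Bool) : Language Bool :=
  {x | 2 * (2 : ℤ) ^ Δ.p.eval x.length ≤ 3 * Δ.gap B Z x}

/-- **Well-formed descriptions**: both machines are polynomial-time, output on EVERY run within
their fuel and ask only queries of length at most the fuel, against every oracle (the normal form
of `normalize`; it makes the semantics total and local at foreign oracles).
[cite: FennerFortnowKurtzLi2003IC, §6.1 (p. 25, "M runs in time nᵏ … the length of each oracle query is also bounded by nᵏ")] -/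
def WellFormed (Δ : AWPPDescr) : Prop :=
  Δ.M₁.IsPolyTime encodingBoolBool ∧ Δ.M₂.IsPolyTime encodingBoolBool ∧
    (∀ (O : Oracle) (z : List Bool), (Δ.M₁.run O (Δ.q₁.eval z.length) z).isSome ∧
      ∀ y ∈ Δ.M₁.queries O (Δ.q₁.eval z.length) z, y.length ≤ Δ.q₁.eval z.length) ∧
    (∀ (O : Oracle) (z : List Bool), (Δ.M₂.run O (Δ.q₂.eval z.length) z).isSome ∧
      ∀ y ∈ Δ.M₂.queries O (Δ.q₂.eval z.length) z, y.length ≤ Δ.q₂.eval z.length)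

/-- **Categorical over `σ`** ("`M` is categorical over `σ`": proper for every oracle extending
`σ`): the promise holds at every input for every `Z` extending the finite condition `σ`.
[cite: FennerFortnowKurtzLi2003IC, §6.2 (p. 27) and §6.5 (p. 32)] -/
def Categorical (σ : CohenCondition) : Prop :=
  ∀ Z : Language Bool, σ.ExtendedBy Z → ∀ x : List Bool, Δ.Prom B Z x

/-! ### Locality of the promise -/

/-- The `Z`-parts of the queries of the two machines on the witnesses of `x` (against `B ⊕ Z`):
the finitely many strings of `Z` the promise at `x` can depend on. [cite: FennerFortnowKurtzLi2003IC, §6.5 (p. 32, finite conditions)] -/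
def zQueries (Z : Language Bool) (x : List Bool) : Finset (List Bool) :=
  ((univ : Finset (List.Vector Bool (Δ.r₁.eval x.length))).biUnion fun y =>
      (Δ.M₁.queries (Oracle.ofLanguage (oracleJoin B Z)) (Δ.q₁.eval (boolPair x y.toList).length)
        (boolPair x y.toList)).toFinset.image List.tail) ∪
    ((univ : Finset (List.Vector Bool (Δ.r₂.eval x.length))).biUnion fun y =>
      (Δ.M₂.queries (Oracle.ofLanguage (oracleJoin B Z)) (Δ.q₂.eval (boolPair x y.toList).length)
        (boolPair x y.toList)).toFinset.image List.tail)

/-- Joins agree on a query whose tail the right oracles agree on. [cite: AaronsonChen2017, §5 (p. 20, O₀ ⊕ O₁)] -/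
theorem ofLanguage_oracleJoin_eq {B Z Z' : Language Bool} {s : List Bool}
    (h : s.tail ∈ Z' ↔ s.tail ∈ Z) :
    Oracle.ofLanguage (oracleJoin B Z') s = Oracle.ofLanguage (oracleJoin B Z) s := by
  have hiff : s ∈ oracleJoin B Z' ↔ s ∈ oracleJoin B Z := by
    rcases s with _ | ⟨b, t⟩
    · simp
    · cases b
      · simp
      · rw [true_cons_mem_oracleJoin, true_cons_mem_oracleJoin]
        exact h
  rw [Oracle.ofLanguage_apply, Oracle.ofLanguage_apply]
  by_cases hs : s ∈ oracleJoin B Z'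
  · rw [(Set.mem_iff_boolIndicator _ _).1 hs, (Set.mem_iff_boolIndicator _ _).1 (hiff.1 hs)]
  · rw [(Set.notMem_iff_boolIndicator _ _).1 hs,
      (Set.notMem_iff_boolIndicator _ _).1 fun h' => hs (hiff.2 h')]

/-- Counting witnesses only depends on the relation at the witnesses. [folklore] -/
theorem countWitnesses_congr {R R' : Language Bool} {m : ℕ} {x : List Bool}
    (h : ∀ y : List.Vector Bool m, boolPair x y.toList ∈ R ↔ boolPair x y.toList ∈ R') :
    countWitnesses R m x = countWitnesses R' m x := by
  classical
  unfold countWitnesses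
  congr 1
  exact Finset.filter_congr fun y _ => h y

/-- **Locality of the promise**: if `Z'` agrees with `Z` on the `Z`-parts of the queries of the
two machines on the witnesses of `x`, the two gaps at `x` coincide (runs are determined by the
answers to the queries asked, `OracleAlg.run_congr`). [cite: FennerFortnowKurtzLi2003IC, §6.5 (p. 32)] -/
theorem gap_congr {Z Z' : Language Bool} {x : List Bool}
    (h : ∀ t ∈ Δ.zQueries B Z x, (t ∈ Z' ↔ t ∈ Z)) : Δ.gap B Z' x = Δ.gap B Z x := by
  classical
  have h1 : ∀ y : List.Vector Bool (Δ.r₁.eval x.length),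
      (boolPair x y.toList ∈ {z | Δ.acc₁ B Z' z} ↔ boolPair x y.toList ∈ {z | Δ.acc₁ B Z z}) := by
    intro y
    simp only [Set.mem_setOf_eq, acc₁]
    rw [OracleAlg.run_congr Δ.M₁ (O := Oracle.ofLanguage (oracleJoin B Z))
      (O' := Oracle.ofLanguage (oracleJoin B Z')) fun s hs => ofLanguage_oracleJoin_eq (h _ ?_)]
    unfold zQueries
    refine Finset.mem_union_left _ (Finset.mem_biUnion.2 ⟨y, Finset.mem_univ _, ?_⟩)
    exact Finset.mem_image.2 ⟨s, List.mem_toFinset.2 hs, rfl⟩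
  have h2 : ∀ y : List.Vector Bool (Δ.r₂.eval x.length),
      (boolPair x y.toList ∈ {z | Δ.acc₂ B Z' z} ↔ boolPair x y.toList ∈ {z | Δ.acc₂ B Z z}) := by
    intro y
    simp only [Set.mem_setOf_eq, acc₂]
    rw [OracleAlg.run_congr Δ.M₂ (O := Oracle.ofLanguage (oracleJoin B Z))
      (O' := Oracle.ofLanguage (oracleJoin B Z')) fun s hs => ofLanguage_oracleJoin_eq (h _ ?_)]
    unfold zQueries
    refine Finset.mem_union_right _ (Finset.mem_biUnion.2 ⟨y, Finset.mem_univ _, ?_⟩)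
    exact Finset.mem_image.2 ⟨s, List.mem_toFinset.2 hs, rfl⟩
  simp only [gap, cnt₁, cnt₂, countWitnesses_congr h1, countWitnesses_congr h2]

/-- The promise at `x` only depends on those strings. [cite: FennerFortnowKurtzLi2003IC, §6.5 (p. 32)] -/
theorem prom_congr {Z Z' : Language Bool} {x : List Bool}
    (h : ∀ t ∈ Δ.zQueries B Z x, (t ∈ Z' ↔ t ∈ Z)) : Δ.Prom B Z' x ↔ Δ.Prom B Z x := by
  simp only [Prom, Δ.gap_congr B h]

/-! ### Normal form and extraction from `AWPP^{B ⊕ G}` -/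

/-- The description of the `AWPP^{B ⊕ G}` witness data `(M₁, q₁, r₁, M₂, q₂, r₂, p)` in normal
form: each machine capped at query length `qᵢ` and clocked at `qᵢ` rounds, run with fuel `qᵢ + 1`.
[cite: AroraBarakCC2009, §3.4 (clocked oracle machines)] -/
def normalize (M₁ M₂ : OracleAlg Bool) (q₁ q₂ r₁ r₂ p : Polynomial ℕ) : AWPPDescr where
  M₁ := (M₁.capQ q₁ false).clock q₁ false
  M₂ := (M₂.capQ q₂ false).clock q₂ false
  q₁ := q₁ + 1
  q₂ := q₂ + 1
  r₁ := r₁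
  r₂ := r₂
  p := p

/-- A capped and clocked machine outputs within fuel `q + 1` and asks only queries of length
`≤ q ≤ q + 1`, against every oracle. [cite: AroraBarakCC2009, §3.4] -/
theorem run_capQ_clock_wf (M : OracleAlg Bool) (q : Polynomial ℕ) (O : Oracle) (z : List Bool) :
    (((M.capQ q false).clock q false).run O ((q + 1).eval z.length) z).isSome ∧
      ∀ y ∈ ((M.capQ q false).clock q false).queries O ((q + 1).eval z.length) z,
        y.length ≤ (q + 1).eval z.length := by
  refine ⟨?_, fun y hy => ?_⟩
  · simpa using OracleAlg.run_clock_isSome (M.capQ q false) q false O z (n := (q + 1).eval z.length)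
      (by simp)
  · have h := OracleAlg.length_le_of_mem_queries_capQ M q false O z _
      (OracleAlg.queries_clock_subset _ q false O z _ hy)
    simp only [Polynomial.eval_add, Polynomial.eval_one]
    omega

/-- The normal form is well formed when the machines are polynomial-time. [cite: AroraBarakCC2009, §3.4] -/
theorem wellFormed_normalize {M₁ M₂ : OracleAlg Bool} (h₁ : M₁.IsPolyTime encodingBoolBool)
    (h₂ : M₂.IsPolyTime encodingBoolBool) (q₁ q₂ r₁ r₂ p : Polynomial ℕ) :
    (normalize M₁ M₂ q₁ q₂ r₁ r₂ p).WellFormed :=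
  ⟨OracleAlg.isPolyTime_clock encodingBoolBool (OracleAlg.isPolyTime_capQ encodingBoolBool h₁ q₁ false) q₁ false,
    OracleAlg.isPolyTime_clock encodingBoolBool (OracleAlg.isPolyTime_capQ encodingBoolBool h₂ q₂ false) q₂ false,
    fun O z => run_capQ_clock_wf M₁ q₁ O z, fun O z => run_capQ_clock_wf M₂ q₂ O z⟩

/-- At an oracle where `M` meets its `PRel` clauses (output `b` within `q` rounds, short queries),
the normal form outputs the same `b`. [cite: AroraBarakCC2009, §3.4] -/
theorem run_normalize_eq {M : OracleAlg Bool} {q : Polynomial ℕ} {O : Oracle} {z : List Bool} {b : Bool}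
    (hrun : M.run O (q.eval z.length) z = some b)
    (hq : ∀ y ∈ M.queries O (q.eval z.length) z, y.length ≤ q.eval z.length) :
    ((M.capQ q false).clock q false).run O ((q + 1).eval z.length) z = some b := by
  have hcap : (M.capQ q false).run O (q.eval z.length) z = some b := by
    rw [(OracleAlg.run_capQ M q false O z _ hq).1, hrun]
  simpa using OracleAlg.run_clock_of_run (M.capQ q false) q false O z hcap
    (n := (q + 1).eval z.length) (by simp)

/-- **Extraction**: every `AWPP^{B ⊕ G}` language is the language of a well-formed description
whose promise holds at `G` at every input. [cite: FennerFortnowKurtzLi2003IC, Def. 6.1 (p. 25)] -/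
theorem exists_of_mem_AWPPRel {B G L : Language Bool}
    (hL : L ∈ AWPPRel (Oracle.ofLanguage (oracleJoin B G))) :
    ∃ Δ : AWPPDescr, Δ.WellFormed ∧ (∀ x, Δ.Prom B G x) ∧ Δ.lang B G = L := by
  obtain ⟨g, ⟨f₁, ⟨R₁, ⟨N₁, hN₁, q₁, hR₁⟩, r₁, hf₁⟩, f₂, ⟨R₂, ⟨N₂, hN₂, q₂, hR₂⟩, r₂, hf₂⟩, hg⟩, p, hp⟩ := hL
  refine ⟨normalize N₁ N₂ q₁ q₂ r₁ r₂ p, wellFormed_normalize hN₁ hN₂ q₁ q₂ r₁ r₂ p, ?_⟩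
  -- the gap of the normal form at `G` is `g`
  have hacc₁ : ∀ z, (normalize N₁ N₂ q₁ q₂ r₁ r₂ p).acc₁ B G z ↔ z ∈ R₁ := by
    intro z
    simp only [acc₁, normalize]
    rw [run_normalize_eq (hR₁ z).1 (hR₁ z).2, Option.some.injEq, ← Set.mem_iff_boolIndicator]
    exact Iff.rfl
  have hacc₂ : ∀ z, (normalize N₁ N₂ q₁ q₂ r₁ r₂ p).acc₂ B G z ↔ z ∈ R₂ := by
    intro z
    simp only [acc₂, normalize]
    rw [run_normalize_eq (hR₂ z).1 (hR₂ z).2, Option.some.injEq, ← Set.mem_iff_boolIndicator]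
    exact Iff.rfl
  have hgap : ∀ x, (normalize N₁ N₂ q₁ q₂ r₁ r₂ p).gap B G x = g x := by
    intro x
    have e₁ : {z | (normalize N₁ N₂ q₁ q₂ r₁ r₂ p).acc₁ B G z} = R₁ := Set.ext hacc₁
    have e₂ : {z | (normalize N₁ N₂ q₁ q₂ r₁ r₂ p).acc₂ B G z} = R₂ := Set.ext hacc₂
    simp only [gap, cnt₁, cnt₂, e₁, e₂, hg x, hf₁ x, hf₂ x]
    rfl
  refine ⟨fun x => ?_, Set.ext fun x => ?_⟩
  · simp only [Prom, hgap]
    by_cases hx : x ∈ L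
    · exact Or.inl ((hp x).1 hx)
    · exact Or.inr ((hp x).2 hx)
  · simp only [lang, Set.mem_setOf_eq, hgap]
    change 2 * (2 : ℤ) ^ p.eval x.length ≤ 3 * g x ↔ x ∈ L
    constructor
    · intro h
      by_contra hx
      have := (hp x).2 hx
      have h2 : (0 : ℤ) < 2 ^ p.eval x.length := by positivity
      linarith [this.2]
    · exact fun hx => ((hp x).1 hx).1

end AWPPDescr

/-! ### `P^{B ⊕ G} ⊆ AWPP^{B ⊕ G}` -/

/-- `P^{B ⊕ G} ⊆ AWPP^{B ⊕ G}`, unconditionally: `P^A ⊆ BPP^A ⊆ BQP^A ⊆ AWPP^A`, all proved in the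
tree (`PRel_subset_BPPRel_holds`, `BPPRel_ofLanguage_subset_BQPRel_of_sim
uniformOracleCoinSimulation_holds`, `BQPRel_subset_AWPPRel_holds`).
[cite: FortnowRogers1999JCSS, Thm. 3.1 and §3 (arXiv numbering)] -/
theorem PRel_subset_AWPPRel_ofLanguage (A : Language Bool) :
    PRel (Oracle.ofLanguage A) ⊆ AWPPRel (Oracle.ofLanguage A) :=
  (PRel_ofLanguage_subset_BQPRel_of_BPPRel
      (BPPRel_ofLanguage_subset_BQPRel_of_sim uniformOracleCoinSimulation_holds)
      PRel_subset_BPPRel_holds A).trans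
    (BQPRel_subset_AWPPRel_holds A)

namespace FFKL

/-! ### Requirements, their forcing sets, and the family -/

/-- **The requirement of a description** ("Either `M^X` is not proper or `L(M^X) ∈ P^X`"): if the
promise holds at every input relative to `B ⊕ G`, the language described is in `P^{B ⊕ G}`.
[cite: FennerFortnowKurtzLi2003IC, Lemma 6.8 (p. 28, requirement Rᵢ)] -/
def req (B : Language Bool) (Δ : AWPPDescr) (G : Language Bool) : Prop :=
  (∀ x : List Bool, Δ.Prom B G x) → Δ.lang B G ∈ PRel (Oracle.ofLanguage (oracleJoin B G))

/-- The family of forcing sets of the requirements of all well-formed descriptions.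
[cite: FennerFortnowKurtzLi2003IC, Lemma 6.8 and §6.5] -/
def family (B : Language Bool) : Set (Set CohenCondition) :=
  (fun Δ : AWPPDescr => {σ : CohenCondition | σ.Forces (req B Δ)}) '' {Δ | Δ.WellFormed}

/-- Descriptions with polynomial-time machines are countably many. [cite: AroraBarakCC2009, §1.4.1] -/
theorem countable_wellFormed : Set.Countable {Δ : AWPPDescr | Δ.WellFormed} := by
  haveI := countable_polynomial_nat
  haveI : Countable {M : OracleAlg Bool // M.IsPolyTime encodingBoolBool} :=
    (countable_polyTimeOracleAlg_holds).to_subtype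
  have hsub : {Δ : AWPPDescr | Δ.WellFormed} ⊆ Set.range
      (fun t : {M : OracleAlg Bool // M.IsPolyTime encodingBoolBool} ×
          {M : OracleAlg Bool // M.IsPolyTime encodingBoolBool} ×
          Polynomial ℕ × Polynomial ℕ × Polynomial ℕ × Polynomial ℕ × Polynomial ℕ =>
        (⟨t.1.1, t.2.1.1, t.2.2.1, t.2.2.2.1, t.2.2.2.2.1, t.2.2.2.2.2.1, t.2.2.2.2.2.2⟩ : AWPPDescr)) := by
    rintro ⟨M₁, M₂, q₁, q₂, r₁, r₂, p⟩ ⟨h₁, h₂, -, -⟩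
    exact ⟨(⟨M₁, h₁⟩, ⟨M₂, h₂⟩, q₁, q₂, r₁, r₂, p), rfl⟩
  exact (Set.countable_range _).mono hsub

/-- The family is countable. [cite: AroraBarakCC2009, §1.4.1] -/
theorem family_countable (B : Language Bool) : (family B).Countable :=
  countable_wellFormed.image _

/-! ### The finite-extension half: forcing a violation of the promise -/

/-- **A violation of the promise below `τ` is forced by a finite extension of `τ`**: if some `Z`
extending `τ` violates the promise at `x`, the restriction of `Z` to `dom τ` and the finitely many
strings the promise at `x` reads extends `τ` and forces the violation ("there is some `α ≺ A` of
finite domain such that for all `B` extending `α`, `M^B` is not proper").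
[cite: FennerFortnowKurtzLi2003IC, Lemma 6.8 (proof, p. 28) and §6.5 (p. 32)] -/
theorem exists_forces_not_prom (B : Language Bool) (Δ : AWPPDescr) {τ : CohenCondition}
    {Z : Language Bool} (hZ : τ.ExtendedBy Z) {x : List Bool} (hx : ¬ Δ.Prom B Z x) :
    ∃ σ : CohenCondition, τ ≤ σ ∧ σ.Forces fun G => ¬ Δ.Prom B G x := by
  classical
  refine ⟨restrict Z (τ.dom_finite.toFinset ∪ Δ.zQueries B Z x),
    le_restrict_of_extendedBy hZ fun q hq => ?_, fun G hG hprom => hx ?_⟩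
  · simp only [Finset.coe_union, Set.Finite.coe_toFinset, Set.mem_union]
    exact Or.inl hq
  · refine (Δ.prom_congr B fun t ht => ?_).1 hprom
    refine hG.mem_iff_mem (extendedBy_restrict Z _) ?_
    rw [dom_restrict]
    simp only [Finset.coe_union, Set.Finite.coe_toFinset, Set.mem_union, Finset.mem_coe]
    exact Or.inr ht

/-- **Density of the forcing sets, given the Standard Algorithm for categorical descriptions**
(§6.5: "if a machine is not categorical over some (finite!) Cohen condition, we can force it not
to be proper … Then … we need only deal with categorical machines"): for every `τ`, either some
extension of `τ` violates the promise somewhere — and a finite extension forces this, hence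
forces the requirement vacuously — or the description is categorical over `τ`, and then `τ`
itself forces the requirement by the collapse hypothesis.
[cite: FennerFortnowKurtzLi2003IC, Lemma 6.8 (proof, p. 28), §6.5 (p. 32) and Lemma 6.16] -/
theorem isDense_forces_req_of_stdAlg (B : Language Bool) (Δ : AWPPDescr)
    (hstd : ∀ σ : CohenCondition, Δ.Categorical B σ → ∀ G : Language Bool, σ.ExtendedBy G →
      Δ.lang B G ∈ PRel (Oracle.ofLanguage (oracleJoin B G))) :
    IsDense {σ : CohenCondition | σ.Forces (req B Δ)} := by
  rw [isDense_iff]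
  intro τ
  by_cases h : ∃ Z : Language Bool, τ.ExtendedBy Z ∧ ∃ x : List Bool, ¬ Δ.Prom B Z x
  · obtain ⟨Z, hZ, x, hx⟩ := h
    obtain ⟨σ, hτσ, hσ⟩ := exists_forces_not_prom B Δ hZ hx
    exact ⟨σ, fun G hG hall => absurd (hall x) (hσ G hG), hτσ⟩
  · have hcat : Δ.Categorical B τ := by
      intro Z hZ x
      by_contra hx
      exact h ⟨Z, hZ, x, hx⟩
    exact ⟨τ, fun G hG _ => hstd τ hcat G hG, le_rfl⟩

/-! ### The collapse for generic oracles, and the assembly -/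

/-- **`AWPP^{B ⊕ G} ⊆ P^{B ⊕ G}` for every `family B`-generic `G`, given the Standard Algorithm**:
an `AWPP^{B ⊕ G}` language is described by a well-formed `Δ` whose promise holds at `G`
(`exists_of_mem_AWPPRel`); `G` meets the dense forcing set of `req B Δ`, so the requirement holds,
and its hypothesis is the promise. [cite: FennerFortnowKurtzLi2003IC, Lemma 6.8, Lemma 6.16 and Thm. 6.18 (2)] -/
theorem AWPPRel_subset_PRel_of_isGeneric_of_stdAlg {B G : Language Bool}
    (hstd : ∀ Δ : AWPPDescr, Δ.WellFormed → ∀ σ : CohenCondition, Δ.Categorical B σ →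
      ∀ G : Language Bool, σ.ExtendedBy G → Δ.lang B G ∈ PRel (Oracle.ofLanguage (oracleJoin B G)))
    (hG : IsGeneric (family B) G) :
    AWPPRel (Oracle.ofLanguage (oracleJoin B G)) ⊆ PRel (Oracle.ofLanguage (oracleJoin B G)) := by
  intro L hL
  obtain ⟨Δ, hwf, hprom, rfl⟩ := AWPPDescr.exists_of_mem_AWPPRel hL
  have hreq : req B Δ G :=
    hG.of_forces_of_mem ⟨Δ, hwf, rfl⟩ (isDense_forces_req_of_stdAlg B Δ (hstd Δ hwf)) fun _ h => h
  exact hreq hprom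

/-- **`P^{B ⊕ G} = AWPP^{B ⊕ G}` for every `family B`-generic `G`, given the Standard Algorithm.**
[cite: FennerFortnowKurtzLi2003IC, Thm. 6.18 (2) (p. 33) and pp. 33–34] -/
theorem PRel_eq_AWPPRel_of_isGeneric_of_stdAlg {B G : Language Bool}
    (hstd : ∀ Δ : AWPPDescr, Δ.WellFormed → ∀ σ : CohenCondition, Δ.Categorical B σ →
      ∀ G : Language Bool, σ.ExtendedBy G → Δ.lang B G ∈ PRel (Oracle.ofLanguage (oracleJoin B G)))
    (hG : IsGeneric (family B) G) :
    PRel (Oracle.ofLanguage (oracleJoin B G)) = AWPPRel (Oracle.ofLanguage (oracleJoin B G)) :=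
  Set.Subset.antisymm (PRel_subset_AWPPRel_ofLanguage _)
    (AWPPRel_subset_PRel_of_isGeneric_of_stdAlg hstd hG)

end FFKL

/-- **Fenner–Fortnow–Kurtz–Li Thm. 6.18 (2), rerelativized, from the Standard Algorithm**: the
named fact `fennerFortnowKurtzLi2003_thm618_awpp` follows from the collapse statement for
categorical descriptions — for every Karp-`PSPACE`-complete `B`, every well-formed description
`Δ` categorical over a finite condition `σ`, and every `G` extending `σ`, the language of `Δ`
relative to `B ⊕ G` is in `P^{B ⊕ G}` (Lemma 6.16 with `F_j ∈ FPSPACE ⊆ FP^B`; to be proved in the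
sibling machine files). The family is `FFKL.family B` (countable), the generic collapse is
`FFKL.PRel_eq_AWPPRel_of_isGeneric_of_stdAlg`. [cite: FennerFortnowKurtzLi2003IC, Thm. 6.18 (2) (p. 33), Lemma 6.16, Lemma 6.17 and pp. 33–34] [cite: FortnowRogers1999JCSS, Thm. 3.6 (arXiv numbering)] -/
theorem fennerFortnowKurtzLi2003_thm618_awpp_of_stdAlg
    (hstd : ∀ B : Language Bool, IsComplete PSPACE B → ∀ Δ : AWPPDescr, Δ.WellFormed →
      ∀ σ : CohenCondition, Δ.Categorical B σ → ∀ G : Language Bool, σ.ExtendedBy G →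
        Δ.lang B G ∈ PRel (Oracle.ofLanguage (oracleJoin B G))) :
    fennerFortnowKurtzLi2003_thm618_awpp := fun B hB =>
  ⟨FFKL.family B, FFKL.family_countable B, fun _ hG =>
    FFKL.PRel_eq_AWPPRel_of_isGeneric_of_stdAlg (hstd B hB) hG⟩

end Literature.Barriers.QuantumAdvantage

end
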